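import Summits.BirchSwinnertonDyer.Rank1Residual.X4.LevelLoweringOfOldOnCycles
import Summits.BirchSwinnertonDyer.Rank1Residual.X4.HeckeShiftedDerivativeFamily
import HarnessLib

/-!
# The PATH FUNCTION of an additive functional on `H₁(X₀(M), ℤ)`: `μ_Λ(r) = c·Λ((T_{q₀} − q₀ − 1){∞, r})` is periodic and `H_q μ_Λ = μ_{Λ∘T_q}` for every prime `q ∤ M` — so the shifted derivative `E_q = H_q − a_q` maps `μ_Λ` to `μ_{Λ∘T_q − a_q Λ}`, and the path functions of a Hecke-stable family of functionals form an `E_q`-STABLE set for ALL `q` (cell `b2b-bsdres`, seat additive-p4 gen 32, line V54 — the structural `H`-stability hypotheses of `X4/KuriharaAdditiveCertificateOfExactness.lean`, theory side)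

HONEST FRAMING (verbatim, cell `b2b-bsdres`): the goal of the cell is to DELETE the COMBINATION-SHAPED
residual classes for ALL analytic-rank `≤ 1` curves over `ℚ` — "full BSD formula for every rank `≤ 1`
curve in class `C`" assembled STRICTLY from published theorems — so that the rank-`≤ 1` remainder
becomes exactly the CONSTRUCTION-SHAPED classes, which are TYPED (missing-input Props), NOT attempted;
this is not "finishing BSD". This file: TOOL theorems (modular symbols / period homology; pure
algebra over the tree's `periodHomology` and `heckeTransform`), 0 defs, 0 facts, nothing booked; X4
CONSTRUCTION-SHAPED.

## Why

`X4/KuriharaAdditiveCertificateOfExactness.lean` (K91) derives the additive certificate from the FREE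
decomposition + two-prime exactness, for sets `P₁, P₂, P₀` of periodic functions that are stable under
`E_q = H_q − a_q(E)` for EVERY Kolyvagin prime `q` — an infinite family of conditions. Gen 26's
`isPeriodic_and_heckeRel_of_eigen` (`X4/LevelLoweringOfOldOnCycles.lean`) closed the path at a prime
`q₀ ≡ 1 (mod M)` for an EIGEN functional. This file is its non-eigen form:

* `isPeriodic_pathFun`, **`heckeTransform_pathFun`** — for ANY `k`-valued `Λ` additive on
  `H₁(X₀(M), ℤ)`: `μ_Λ(r) := c·Λ(T_{q₀}•{∞,r} − (q₀+1)•{∞,r})` is `1`-periodic and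
  `H_q μ_Λ (r) = c·Λ(T_q • (T_{q₀}•{∞,r} − (q₀+1)•{∞,r}))` for every prime `q ∤ M` (Manin's closing
  of the path commutes with `T_q`; `∑_j {∞,(r+j)/q} + {∞, q r} = T_q • {∞, r}`, MTT (4.2)).
* **`heckeShift_pathFun`** — hence `E_q μ_Λ = μ_{Λ'}` with `Λ' = Λ(T_q • ·) − a_q Λ(·)`, again
  additive on `H₁(X₀(M), ℤ)` (`additiveOn_shiftFunctional`).
* **`heckeShift_mem_pathFunSet`** — for a family `𝓛` of additive functionals stable under
  `Λ ↦ Λ(T_q • ·) − a_q Λ` (e.g. ANY `𝕋_ℤ`-submodule of `Hom(H₁(X₀(M), ℤ), k)`, or its part cut out by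
  a Hecke idempotent), the set of path functions `{μ_Λ : Λ ∈ 𝓛}` is `E_q`-stable — for every prime
  `q ∤ M` at once. This discharges the hypotheses `hE₁ / hE₂ / hE₀` of K91 for such sets; the
  difference-closure `hsub₀` is `pathFun_sub`.

## References

* Ju. I. Manin, Izv. Akad. Nauk SSSR 36 (1972), Thm. 3.3 (20), Thm. 3.5 (22) (closing the path). [cite: Manin1972, Thm. 3.3 (20) and Thm. 3.5 (22)]
* B. Mazur, J. Tate, J. Teitelbaum, Invent. Math. 84 (1986), §I.4 (4.2). [cite: MazurTateTeitelbaum1986Invent, §I.4 (4.2)]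
* H. Darmon, F. Diamond, R. Taylor, *Fermat's Last Theorem* (1995), §1.6 (p. 41) (`𝕋_ℤ` acts on `H₁`). [cite: DarmonDiamondTaylor1995, §1.6 (p. 41)]
-/

noncomputable section

open scoped MatrixGroups ModularForm

open CongruenceSubgroup Finset Matrix

open Literature.NumberTheory.EllipticCurves Literature.NumberTheory.EllipticCurves.ModularForms
  Literature.NumberTheory.EllipticCurves.ModularForms.HidaCohomology

namespace Summit.BirchSwinnertonDyer.Rank1Residual.LevelLowering

section PathFun

variable {k : Type*} [CommRing k] {M : ℕ} [NeZero M]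

/-- **The path function of an additive functional is periodic**: `μ(r) := c·Λ(T_{q₀}•{∞,r} −
(q₀+1)•{∞,r})` satisfies `μ(r + z) = μ(r)` (`{∞, r + z} = {∞, r}`). [cite: Manin1972, Thm. 3.3 (20) and Thm. 3.5 (22)] -/
theorem isPeriodic_pathFun (Λ : Module.Dual ℂ (CuspForm (Gamma0 M) 2) → k)
    (σ : ℚ → Module.Dual ℂ (CuspForm (Gamma0 M) 2))
    (hσ : ∀ (r : ℚ) (f : CuspForm (Gamma0 M) 2), σ r f = modularSymbol f r)
    {q₀ : ℕ} (hq₀ : q₀.Prime) (c : k) (μ : ℚ → k)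
    (hμ : ∀ r, μ r = c * Λ (HeckeRing0.T M 2 q₀ hq₀ • σ r - ((q₀ + 1 : ℕ) : ℂ) • σ r)) :
    IsPeriodic μ :=
  fun r z ↦ by rw [hμ, hμ, symbol_add_intCast M σ hσ r z]

/-- **`H_q μ_Λ = μ_{Λ∘T_q}`** for the path function `μ_Λ(r) = c·Λ(T_{q₀}•{∞,r} − (q₀+1)•{∞,r})` of
ANY functional `Λ` additive on `H₁(X₀(M), ℤ)`, `q₀ ≡ 1 (mod M)` prime, `q ∤ M` prime:
`∑_{j<q} μ_Λ((r+j)/q) + μ_Λ(q r) = c·Λ(T_q • (T_{q₀}•{∞,r} − (q₀+1)•{∞,r}))` — Manin's closing of the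
path commutes with `T_q` and `∑_j {∞,(r+j)/q} + {∞, q r} = T_q • {∞, r}`.
[cite: MazurTateTeitelbaum1986Invent, §I.4 (4.2)] [cite: Manin1972, Thm. 3.3 (20) and Thm. 3.5 (22)] -/
theorem heckeTransform_pathFun (Λ : Module.Dual ℂ (CuspForm (Gamma0 M) 2) → k)
    (hadd : ∀ x ∈ periodHomology M, ∀ y ∈ periodHomology M, Λ (x + y) = Λ x + Λ y)
    (σ : ℚ → Module.Dual ℂ (CuspForm (Gamma0 M) 2))
    (hσ : ∀ (r : ℚ) (f : CuspForm (Gamma0 M) 2), σ r f = modularSymbol f r)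
    {q₀ : ℕ} (hq₀ : q₀.Prime) (hq₀1 : q₀ ≡ 1 [MOD M]) (c : k) (μ : ℚ → k)
    (hμ : ∀ r, μ r = c * Λ (HeckeRing0.T M 2 q₀ hq₀ • σ r - ((q₀ + 1 : ℕ) : ℂ) • σ r))
    {q : ℕ} (hq : q.Prime) (hqM : ¬ q ∣ M) (r : ℚ) :
    heckeTransform q μ r =
      c * Λ (HeckeRing0.T M 2 q hq • (HeckeRing0.T M 2 q₀ hq₀ • σ r - ((q₀ + 1 : ℕ) : ℂ) • σ r)) := by
  have hmem : ∀ r, HeckeRing0.T M 2 q₀ hq₀ • σ r - ((q₀ + 1 : ℕ) : ℂ) • σ r ∈ periodHomology M :=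
    T_smul_sub_smul_symbol_mem_periodHomology M σ hσ hq₀ hq₀1
  haveI : NeZero q := ⟨hq.ne_zero⟩
  -- the closing operator commutes with `T_q`
  have hA : ∀ y : Module.Dual ℂ (CuspForm (Gamma0 M) 2),
      HeckeRing0.T M 2 q₀ hq₀ • (HeckeRing0.T M 2 q hq • y) -
          ((q₀ + 1 : ℕ) : ℂ) • (HeckeRing0.T M 2 q hq • y) =
        HeckeRing0.T M 2 q hq • (HeckeRing0.T M 2 q₀ hq₀ • y - ((q₀ + 1 : ℕ) : ℂ) • y) := by
    intro y
    rw [smul_sub, smul_smul, smul_smul, mul_comm, Nat.cast_smul_eq_nsmul, Nat.cast_smul_eq_nsmul,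
      smul_comm]
  -- `∑_j σ((r+j)/q) + σ(q r) = T_q • σ r`
  have hsum : ∑ j ∈ Finset.range q, σ ((r + j) / q) + σ (q * r) = HeckeRing0.T M 2 q hq • σ r := by
    rw [← dualMap_heckeT_eq_T_smul hq, dualMap_heckeT_eq_sum M σ hσ hq hqM r,
      ← Fin.sum_univ_eq_sum_range (fun j ↦ σ ((r + j) / q)) q]
    push_cast
    rfl
  show (∑ j ∈ Finset.range q, μ ((r + j) / q)) + μ (q * r) = _
  simp only [hμ]
  rw [← Finset.mul_sum, ← mul_add, ← apply_sum_of_additiveOn Λ hadd _ _ (fun j _ ↦ hmem _),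
    ← hadd _ ((periodHomology M).sum_mem fun j _ ↦ hmem _) _ (hmem _)]
  have e : ∑ j ∈ Finset.range q, (HeckeRing0.T M 2 q₀ hq₀ • σ ((r + j) / q) -
      ((q₀ + 1 : ℕ) : ℂ) • σ ((r + j) / q)) +
      (HeckeRing0.T M 2 q₀ hq₀ • σ (q * r) - ((q₀ + 1 : ℕ) : ℂ) • σ (q * r)) =
      HeckeRing0.T M 2 q hq • (HeckeRing0.T M 2 q₀ hq₀ • σ r - ((q₀ + 1 : ℕ) : ℂ) • σ r) := by
    rw [← hA, ← hsum, smul_add, Finset.smul_sum, smul_add, Finset.smul_sum, Finset.sum_sub_distrib]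
    abel
  rw [e]

/-- **`Λ' := Λ(t • ·) − a·Λ(·)` is again additive on `H₁(X₀(M), ℤ)`** (`𝕋_ℤ` acts on `H₁`).
[cite: DarmonDiamondTaylor1995, §1.6 (p. 41)] -/
theorem additiveOn_shiftFunctional (Λ : Module.Dual ℂ (CuspForm (Gamma0 M) 2) → k)
    (hadd : ∀ x ∈ periodHomology M, ∀ y ∈ periodHomology M, Λ (x + y) = Λ x + Λ y)
    (t : HeckeRing0 M 2) (a : k) :
    ∀ x ∈ periodHomology M, ∀ y ∈ periodHomology M,
      (fun z ↦ Λ (t • z) - a * Λ z) (x + y) =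
        (fun z ↦ Λ (t • z) - a * Λ z) x + (fun z ↦ Λ (t • z) - a * Λ z) y := by
  intro x hx y hy
  simp only [smul_add]
  rw [hadd _ (HeckeRing0.smul_mem_periodHomology M t hx) _ (HeckeRing0.smul_mem_periodHomology M t hy),
    hadd x hx y hy]
  ring

/-- **`E_q μ_Λ = μ_{Λ∘T_q − a_q Λ}`**: the shifted Hecke derivative of a path function is the path
function of the shifted functional (`q ∤ M` prime, `q₀ ≡ 1 (mod M)`).
[cite: MazurTateTeitelbaum1986Invent, §I.4 (4.2)] -/
theorem heckeShift_pathFun (a : ℕ → k) (Λ : Module.Dual ℂ (CuspForm (Gamma0 M) 2) → k)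
    (hadd : ∀ x ∈ periodHomology M, ∀ y ∈ periodHomology M, Λ (x + y) = Λ x + Λ y)
    (σ : ℚ → Module.Dual ℂ (CuspForm (Gamma0 M) 2))
    (hσ : ∀ (r : ℚ) (f : CuspForm (Gamma0 M) 2), σ r f = modularSymbol f r)
    {q₀ : ℕ} (hq₀ : q₀.Prime) (hq₀1 : q₀ ≡ 1 [MOD M]) (c : k) (μ : ℚ → k)
    (hμ : ∀ r, μ r = c * Λ (HeckeRing0.T M 2 q₀ hq₀ • σ r - ((q₀ + 1 : ℕ) : ℂ) • σ r))
    {q : ℕ} (hq : q.Prime) (hqM : ¬ q ∣ M) :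
    heckeShift a q μ = fun r ↦ c * (fun z ↦ Λ (HeckeRing0.T M 2 q hq • z) - a q * Λ z)
      (HeckeRing0.T M 2 q₀ hq₀ • σ r - ((q₀ + 1 : ℕ) : ℂ) • σ r) := by
  funext r
  rw [heckeShift_apply, heckeTransform_pathFun Λ hadd σ hσ hq₀ hq₀1 c μ hμ hq hqM r, hμ r]
  ring

/-- `μ_Λ − μ_{Λ'} = μ_{Λ − Λ'}` (differences of path functions are path functions). [folklore] -/
theorem pathFun_sub (Λ Λ' : Module.Dual ℂ (CuspForm (Gamma0 M) 2) → k)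
    (σ : ℚ → Module.Dual ℂ (CuspForm (Gamma0 M) 2)) {q₀ : ℕ} (hq₀ : q₀.Prime) (c : k)
    (μ μ' : ℚ → k)
    (hμ : ∀ r, μ r = c * Λ (HeckeRing0.T M 2 q₀ hq₀ • σ r - ((q₀ + 1 : ℕ) : ℂ) • σ r))
    (hμ' : ∀ r, μ' r = c * Λ' (HeckeRing0.T M 2 q₀ hq₀ • σ r - ((q₀ + 1 : ℕ) : ℂ) • σ r)) :
    (fun r ↦ μ r - μ' r) = fun r ↦ c * (fun z ↦ Λ z - Λ' z)
      (HeckeRing0.T M 2 q₀ hq₀ • σ r - ((q₀ + 1 : ℕ) : ℂ) • σ r) := by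
  funext r
  rw [hμ, hμ']
  ring

/-- **THE PATH FUNCTIONS OF A HECKE-STABLE FAMILY OF FUNCTIONALS FORM AN `E_q`-STABLE SET — for every
prime `q ∤ M` at once.** Let `𝓛` be a set of `k`-valued functions additive on `H₁(X₀(M), ℤ)` and
stable under `Λ ↦ Λ(T_q • ·) − a_q Λ` for the primes `q ∤ M` (any `𝕋_ℤ`-submodule of
`Hom(H₁(X₀(M), ℤ), k)` qualifies, as does its image under a Hecke idempotent). Then the set
`P = {μ : ∃ Λ ∈ 𝓛, μ = c·Λ((T_{q₀} − q₀ − 1)•{∞, ·})}` of path functions satisfies: `μ ∈ P`, `q ∤ M`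
prime ⟹ `E_q μ ∈ P` — the hypotheses `hE₁ / hE₂ / hE₀` of
`X4/KuriharaAdditiveCertificateOfExactness.plusSymbolLevelLowersAdditivelyModAt_of_exact` for such
`P` (the Kolyvagin primes do not divide the level). [cite: MazurTateTeitelbaum1986Invent, §I.4 (4.2)]
[cite: DarmonDiamondTaylor1995, §1.6 (p. 41)] -/
theorem heckeShift_mem_pathFunSet (a : ℕ → k) (𝓛 : Set (Module.Dual ℂ (CuspForm (Gamma0 M) 2) → k))
    (hadd : ∀ Λ ∈ 𝓛, ∀ x ∈ periodHomology M, ∀ y ∈ periodHomology M, Λ (x + y) = Λ x + Λ y)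
    (hstab : ∀ Λ ∈ 𝓛, ∀ (q : ℕ) (hq : q.Prime), ¬ q ∣ M →
      (fun z ↦ Λ (HeckeRing0.T M 2 q hq • z) - a q * Λ z) ∈ 𝓛)
    (σ : ℚ → Module.Dual ℂ (CuspForm (Gamma0 M) 2))
    (hσ : ∀ (r : ℚ) (f : CuspForm (Gamma0 M) 2), σ r f = modularSymbol f r)
    {q₀ : ℕ} (hq₀ : q₀.Prime) (hq₀1 : q₀ ≡ 1 [MOD M]) (c : k)
    {μ : ℚ → k} (hμP : ∃ Λ ∈ 𝓛, ∀ r, μ r = c * Λ (HeckeRing0.T M 2 q₀ hq₀ • σ r - ((q₀ + 1 : ℕ) : ℂ) • σ r))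
    {q : ℕ} (hq : q.Prime) (hqM : ¬ q ∣ M) :
    ∃ Λ' ∈ 𝓛, ∀ r, heckeShift a q μ r =
      c * Λ' (HeckeRing0.T M 2 q₀ hq₀ • σ r - ((q₀ + 1 : ℕ) : ℂ) • σ r) := by
  obtain ⟨Λ, hΛ, hμ⟩ := hμP
  refine ⟨fun z ↦ Λ (HeckeRing0.T M 2 q hq • z) - a q * Λ z, hstab Λ hΛ q hq hqM, fun r ↦ ?_⟩
  rw [heckeShift_pathFun a Λ (hadd Λ hΛ) σ hσ hq₀ hq₀1 c μ hμ hq hqM]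

/-- The set of path functions of `𝓛` is closed under differences when `𝓛` is (the hypothesis
`hsub₀` of K91). [folklore] -/
theorem sub_mem_pathFunSet (𝓛 : Set (Module.Dual ℂ (CuspForm (Gamma0 M) 2) → k))
    (hsub : ∀ Λ ∈ 𝓛, ∀ Λ' ∈ 𝓛, (fun z ↦ Λ z - Λ' z) ∈ 𝓛)
    (σ : ℚ → Module.Dual ℂ (CuspForm (Gamma0 M) 2)) {q₀ : ℕ} (hq₀ : q₀.Prime) (c : k)
    {μ μ' : ℚ → k}
    (hμP : ∃ Λ ∈ 𝓛, ∀ r, μ r = c * Λ (HeckeRing0.T M 2 q₀ hq₀ • σ r - ((q₀ + 1 : ℕ) : ℂ) • σ r))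
    (hμ'P : ∃ Λ ∈ 𝓛, ∀ r, μ' r = c * Λ (HeckeRing0.T M 2 q₀ hq₀ • σ r - ((q₀ + 1 : ℕ) : ℂ) • σ r)) :
    ∃ Λ'' ∈ 𝓛, ∀ r, μ r - μ' r =
      c * Λ'' (HeckeRing0.T M 2 q₀ hq₀ • σ r - ((q₀ + 1 : ℕ) : ℂ) • σ r) := by
  obtain ⟨Λ, hΛ, hμ⟩ := hμP
  obtain ⟨Λ', hΛ', hμ'⟩ := hμ'P
  refine ⟨fun z ↦ Λ z - Λ' z, hsub Λ hΛ Λ' hΛ', fun r ↦ ?_⟩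
  rw [hμ, hμ']
  ring

/-- Every path function of `𝓛` is periodic (the hypothesis `hP₀` of K91). [folklore] -/
theorem isPeriodic_of_mem_pathFunSet (𝓛 : Set (Module.Dual ℂ (CuspForm (Gamma0 M) 2) → k))
    (σ : ℚ → Module.Dual ℂ (CuspForm (Gamma0 M) 2))
    (hσ : ∀ (r : ℚ) (f : CuspForm (Gamma0 M) 2), σ r f = modularSymbol f r)
    {q₀ : ℕ} (hq₀ : q₀.Prime) (c : k) {μ : ℚ → k}
    (hμP : ∃ Λ ∈ 𝓛, ∀ r, μ r = c * Λ (HeckeRing0.T M 2 q₀ hq₀ • σ r - ((q₀ + 1 : ℕ) : ℂ) • σ r)) :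
    IsPeriodic μ := by
  obtain ⟨Λ, _, hμ⟩ := hμP
  exact isPeriodic_pathFun Λ σ hσ hq₀ c μ hμ

end PathFun

end Summit.BirchSwinnertonDyer.Rank1Residual.LevelLowering

end
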